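import Literature.AlgebraicGeometry.Frobenioids.PerfectionSquareNotOneUnique
import HarnessLib

/-!
# Frobenioids I, Theorem 3.4 (iii), (iv): the typed SCHEMATA `Thm34iii_pf`, `Thm34iv_untr` of
# `BaseCategoryTheoreticity.lean` have FALSE universal closures (kernel witnesses)

Mochizuki, *The geometry of Frobenioids I: the general theory*, Kyushu J. Math. **62** (2008)
293–400, Thm. 3.4 (iii) p. 62 l. 42 – p. 63 l. 2, (iv) p. 63 ll. 5–21 [cite: MochizukiFrdI2008, Thm. 3.4 (iv) p.63].

PROOF-ONLY companion of `BaseCategoryTheoreticity.lean` (seat abc-iut-L1-t3), written for the abc-iut cell's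
FROZEN FACT-LIST rows F-0904 `PreFrobenioidData.Thm34iii_pf` and F-0906 `PreFrobenioidData.Thm34iv_untr`
(seat abc-iut-f-019; cell rule R5: "a universal closure of a schema row is not a fact"). Both declarations are
conclusion predicates with a FREE DATUM beyond the Frobenioids and `Ψ` — a perfection datum
`P_i : PerfectionData S_i`, resp. a functor `Ψ^istr : C₁^istr ⥤ C₂^istr` ("the functor of (i), a parameter
here") — so binding their universal closure as a hypothesis binds `False`. Kernel witnesses, both on the GENUINE
standard-type Frobenioid `DegreeModel.C` (the model Frobenioid of `(pt, ℕ, 0, 0)`, [FrdI] Thm. 5.2; seat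
abc-iut-L1-d4's `DegreeModelFrobenioid.lean`) and `Ψ = 𝟭`:

* `PreFrobenioidData.not_forall_thm34iii_pf` — corollary of seat abc-iut-L1-d4's `DegreeModel.not_thm34iii_pf`
  (`PerfectionSquareNotOneUnique.lean`): at THE perfection datum the bare `1`-uniqueness clause fails (the
  typed reading is stronger than print outside perfect type; the faithful readings — structure-compatible
  uniqueness `PfSquareR`, the perfect-type case — are theorems, see `BaseCategoryTheoreticityInstances.lean`);
* `DegreeModel.not_thm34iv_untr_const` / `PreFrobenioidData.not_forall_thm34iv_untr` — at the junk datum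
  `Ψ^istr :=` the constant functor at the object of degree `1`: all five antecedents of `Thm34iv_untr` hold
  ((a) standard type, (b) `HypB`, (c) the one-morphism base is slim hence Frobenius-slim), but no equivalence
  `Ψ^un-tr` satisfies `Ψ^un-tr ∘ (C^istr → C^un-tr) ≅ (C^istr → C^un-tr) ∘ const`: it would identify the images
  of the objects of degrees `2` and `1`, and `C` has no arrow from degree `2` to degree `1`
  (`deg(B) = deg_Fr(φ)·deg(A) + Div(φ) ≥ deg(A)`). At THE `Ψ^istr` (the restriction of `Ψ`) the typed statement
  holds for every pair of Frobenioids (`FrdI.thm34iv_untr_ofFunctor`).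

This file refutes typed READINGS (universal closures over free data), not the printed theorem; no statement of
the paper is asserted false; no definition; nothing here bears on [IUTchIII].
-/

noncomputable section

namespace Literature.AlgebraicGeometry.Frobenioids

open CategoryTheory Opposite

namespace DegreeModel

/-! ### The degree model satisfies hypothesis (c) of Thm. 3.4 (iv); its objects are isotropic -/

/-- The one-morphism base category is slim (a thin category: every slice-forgetful functor is rigid).
[cite: MochizukiFrdI2008, §0 p.14] -/
theorem isSlim_D : IsSlim D :=
  ⟨fun _ α => by
    ext X
    exact Subsingleton.elim _ _⟩

/-- … hence Frobenius-slim (Def. 3.1 (i): "every slim category is Frobenius-slim").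
[cite: MochizukiFrdI2008, Def. 3.1 (i) p.56] -/
theorem isFrobeniusSlim_D : IsFrobeniusSlim D := isSlim_D.isFrobeniusSlim

/-- Every object of the degree model is isotropic (Thm. 5.2 (ii): model Frobenioids are of isotropic type),
in the data-level rendering of §3. [cite: MochizukiFrdI2008, Thm. 5.2 (ii) p.101] -/
theorem isIsotropic_data (X : C) : (ModelFrobenioid.data natΦ B DivB).IsIsotropic X :=
  (PreFrobenioidData.ofFunctor_isIsotropic F X).2 (ModelFrobenioid.isIsotropic objectwise_isGroupLike_B X)

/-- There is no arrow from the object of degree `2` to the object of degree `1`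
(`deg_Fr(φ) · deg(A) ≤ deg(B)` with `deg_Fr(φ) ≥ 1`). [cite: MochizukiFrdI2008, Thm. 5.2 (i) p.100] -/
theorem isEmpty_hom_ι_two_one : IsEmpty (ι 2 ⟶ ι 1) := by
  refine ⟨fun φ => ?_⟩
  have h := degFr_mul_dg_le φ
  rw [dg_ι, dg_ι] at h
  have hk : 0 < (ModelFrobenioid.degFr φ : ℕ) := (ModelFrobenioid.degFr φ).pos
  omega

/-! ### Thm. 3.4 (iv), unit-trivialisation square: the schema over a free `Ψ^istr` is false -/

/-- **The typed `PreFrobenioidData.Thm34iv_untr` FAILS at a junk `Ψ^istr`**: for the standard-type Frobenioid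
`C` of the degree model (slim, hence Frobenius-slim, one-morphism base; `HypB` for `Ψ = 𝟭`), and
`Ψ^istr :=` the constant functor `C^istr ⥤ C^istr` at the (isotropic) object of degree `1`, there is NO
`Ψ^un-tr` with `OneUniqueSquare Ψ^istr (C^istr → C^un-tr) (C^istr → C^un-tr) Ψ^un-tr`: an equivalence `Ψ^un-tr`
with `(C^istr → C^un-tr) ⋙ Ψ^un-tr ≅ Ψ^istr ⋙ (C^istr → C^un-tr) = const` identifies, being fully faithful, the
classes of the objects of degrees `2` and `1` in `C^un-tr`, whence (the projection `C^istr → C^un-tr` being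
full) an arrow `deg 2 → deg 1` of `C` — there is none. The parameter `Ψ^istr` of the schema must be THE
functor of Thm. 3.4 (i). [cite: MochizukiFrdI2008, Thm. 3.4 (iv) p.63] -/
theorem not_thm34iv_untr_const :
    ¬ PreFrobenioidData.Thm34iv_untr (ModelFrobenioid.data natΦ B DivB) (ModelFrobenioid.data natΦ B DivB)
        (CategoryTheory.Equivalence.refl (C := C))
        ((Functor.const (ModelFrobenioid.data natΦ B DivB).Istr).obj ⟨ι 1, isIsotropic_data (ι 1)⟩) := by
  intro h
  obtain ⟨Ψuntr, ⟨hequiv, ⟨i⟩, -⟩, -⟩ :=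
    h isOfStandardType isOfStandardType hypB isFrobeniusSlim_D isFrobeniusSlim_D
  let A₁ : (ModelFrobenioid.data natΦ B DivB).Istr := ⟨ι 1, isIsotropic_data (ι 1)⟩
  let A₂ : (ModelFrobenioid.data natΦ B DivB).Istr := ⟨ι 2, isIsotropic_data (ι 2)⟩
  -- `Ψ^un-tr [A₂] ≅ [A₁] ≅ Ψ^un-tr [A₁]`
  have e : Ψuntr.obj ((ModelFrobenioid.data natΦ B DivB).toUntr.obj A₂) ≅
      Ψuntr.obj ((ModelFrobenioid.data natΦ B DivB).toUntr.obj A₁) := (i.app A₂).symm ≪≫ i.app A₁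
  -- `Ψ^un-tr` is fully faithful: `[A₂] ≅ [A₁]` in `C^un-tr`; the projection is full: an arrow `A₂ → A₁`
  have f : A₂ ⟶ A₁ := (ModelFrobenioid.data natΦ B DivB).toUntr.preimage (Ψuntr.preimageIso e).hom
  exact isEmpty_hom_ι_two_one.false f.hom

end DegreeModel

namespace PreFrobenioidData

/-! ### The universal closures, refuted -/

/-- **The universal closure of the schema `PreFrobenioidData.Thm34iv_untr` is FALSE** (over the free functor
`Ψ^istr`; witness `DegreeModel.not_thm34iv_untr_const`, a genuine standard-type Frobenioid with `Ψ = 𝟭` and a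
constant `Ψ^istr`). Consumers may bind it only at THE `Ψ^istr` of Thm. 3.4 (i) (`FrdI.thm34iv_untr_ofFunctor`).
[cite: MochizukiFrdI2008, Thm. 3.4 (iv) p.63] -/
theorem not_forall_thm34iv_untr :
    ¬ ∀ {C₁ : Type} [Category.{0} C₁] {D₁ : Type} [Category.{0} D₁] {C₂ : Type} [Category.{0} C₂]
        {D₂ : Type} [Category.{0} D₂] (S₁ : PreFrobenioidData.{0} C₁ D₁) (S₂ : PreFrobenioidData.{0} C₂ D₂)
        (Ψ : C₁ ≌ C₂) (Ψistr : S₁.Istr ⥤ S₂.Istr), Thm34iv_untr S₁ S₂ Ψ Ψistr :=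
  fun h => DegreeModel.not_thm34iv_untr_const (h _ _ _ _)

/-- **The universal closure of the schema `PreFrobenioidData.Thm34iii_pf` is FALSE** (over the free perfection
data `P₁, P₂`; witness seat abc-iut-L1-d4's `DegreeModel.not_thm34iii_pf`: at THE perfection of the degree
model and `Ψ = 𝟭` the bare `1`-uniqueness clause fails). Consumers may bind it only where the bare reading is a
theorem (perfect type, `FrdI.thm34iii_pf_ofFunctor_of_isOfPerfectType`) or use the structure-compatible square
`pfSquareR_map`. [cite: MochizukiFrdI2008, Thm. 3.4 (iii) p.62] -/
theorem not_forall_thm34iii_pf :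
    ¬ ∀ {C₁ : Type} [Category.{0} C₁] {D₁ : Type} [Category.{0} D₁] {C₂ : Type} [Category.{0} C₂]
        {D₂ : Type} [Category.{0} D₂] (S₁ : PreFrobenioidData.{0} C₁ D₁) (S₂ : PreFrobenioidData.{0} C₂ D₂)
        (Ψ : C₁ ≌ C₂) (P₁ : PerfectionData S₁) (P₂ : PerfectionData S₂), Thm34iii_pf S₁ S₂ Ψ P₁ P₂ :=
  fun h => DegreeModel.not_thm34iii_pf (h _ _ _ _ _)

end PreFrobenioidData

end Literature.AlgebraicGeometry.Frobenioids

end
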